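import Literature.Computability.AlgebraicComplexity.MS21ANFHasseBlockExtraction
import Literature.Computability.AlgebraicComplexity.MS21DiagonalTensorDifferenceLemmas
import Literature.Computability.AlgebraicComplexity.MS21ANFHasseQuarterStructure
import HarnessLib

/-!
# The ANF structure lemma: a change of basis whose second-order Hasse data vanish maps `ANF_Δ`
# into its own support (B36 structure lemma, stage S4; cell `val-lit`, seat t18 g5)

Theorem-only file. Blueprint v2 `HOME/np/t18g5-MS21-thm35-B36-hasse-blueprint.md`; this is the
characteristic-free replacement of the second bullet of [MediniShpilka2021, Lemma 5.13
(arXiv:2102.05632 p0029:L3-L26)] (registry item B36): in characteristic `p` the pure second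
derivatives `∂²/∂y_i²` are replaced by the order-2 Hasse derivatives `Δ²_{e_i}`.

Generic lemmas (rank of a supported family of rows, invertibility of diagonal blocks of a
block-monomial matrix, coefficients of products on disjoint variable blocks, Hasse chain rule for
`affSubst le_rfl M 0`) and then `MS2021.support_affSubst_anf_subset_of_cols`: if `M` is invertible,
every `Δ²_{col_k M} ANF_Δ = 0` and `∂_{col_k M}∂_{col_l M} ANF_Δ = 0` for every `+`-pair `(k,l)`,
then `supp ANF_Δ(My) ⊆ supp ANF_Δ`; packaged downstairs as `MS2021.hasse_separates_affSubst_anf`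
(the `h513'` brick of `thm35Core`).

No definitions, no facts (D-0026). HONEST FRAMING: a characteristic-free form of one lemma of a 2021
paper; `VP ≠ VNP` is NOT proved and nothing here bears on it.

## References
* [MediniShpilka2021] D. Medini, A. Shpilka, CCC 2021 (LIPIcs 200:19) = arXiv:2102.05632: Def 8,
  Obs 5.8 / Cor 5.10 (p0025:L57-L70), Claim 5.11, Lemma 5.13 (p0029:L3-L26).
-/

noncomputable section

open MvPolynomial

namespace Literature.Computability.AlgebraicComplexity

namespace MS2021

/-! ### Generic linear algebra -/

section LinAlg

variable {K : Type*} [Field K] {n : ℕ}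

/-- Rows of an invertible matrix indexed through an injection are linearly independent. [folklore] -/
private theorem linearIndependent_rows_comp (M : Matrix (Fin n) (Fin n) K) (hM : IsUnit M.det)
    {ι : Type*} (e : ι → Fin n) (he : Function.Injective e) :
    LinearIndependent K (fun j => M (e j)) := by
  have h : LinearIndependent K M.row :=
    Matrix.linearIndependent_rows_iff_isUnit.2 ((Matrix.isUnit_iff_isUnit_det M).2 hM)
  exact h.comp e he

/-- **Rank bound**: if `|ι|` rows of an invertible matrix (through an injection `e`) are all
supported inside a set `U` of columns then `|ι| ≤ |U|`. [cite: MediniShpilka2021, proof of Lemma 5.13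
(arXiv p0029:L14-L20), the count "there must be some `k ≤ 2·4^{Δ-1}`"] -/
theorem card_le_card_of_rows_supported (M : Matrix (Fin n) (Fin n) K) (hM : IsUnit M.det)
    {ι : Type*} [Fintype ι] (e : ι → Fin n) (he : Function.Injective e) (U : Finset (Fin n))
    (hU : ∀ j w, w ∉ U → M (e j) w = 0) : Fintype.card ι ≤ U.card := by
  classical
  have hli := linearIndependent_rows_comp M hM e he
  -- restrict the rows to the coordinates in `U`
  have hres : LinearIndependent K (fun j => (fun w : U => M (e j) w.1)) := by
    rw [Fintype.linearIndependent_iff]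
    intro g hg j
    have hfull : ∑ i, g i • M (e i) = 0 := by
      funext w
      rw [Finset.sum_apply, Pi.zero_apply]
      by_cases hw : w ∈ U
      · have := congr_fun hg ⟨w, hw⟩
        rw [Finset.sum_apply, Pi.zero_apply] at this
        simpa using this
      · exact Finset.sum_eq_zero fun i _ => by rw [Pi.smul_apply, hU i w hw, smul_zero]
    exact (Fintype.linearIndependent_iff.1 hli) g hfull j
  have := hres.fintype_card_le_finrank
  rwa [Module.finrank_fintype_fun_eq_card, Fintype.card_coe] at this

/-- **Diagonal blocks of a block-monomial invertible matrix are invertible**: if the rows `e j` of an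
invertible `M` vanish outside the columns `e' j'`, the square block `(M (e j) (e' j'))` is invertible.
[cite: MediniShpilka2021, Claim 5.11 / proof of Lemma 5.13 (arXiv p0026, p0029:L20-L26)] -/
private theorem isUnit_det_block' (M : Matrix (Fin n) (Fin n) K) (hM : IsUnit M.det) {m : ℕ}
    (e e' : Fin m → Fin n) (he : Function.Injective e)
    (hsupp : ∀ j w, (∀ j', w ≠ e' j') → M (e j) w = 0) :
    IsUnit (Matrix.of fun j j' => M (e j) (e' j')).det := by
  classical
  have hli := linearIndependent_rows_comp M hM e he
  rw [← Matrix.isUnit_iff_isUnit_det, ← Matrix.linearIndependent_rows_iff_isUnit,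
    Fintype.linearIndependent_iff]
  intro g hg j
  have hfull : ∑ i, g i • M (e i) = 0 := by
    funext w
    rw [Finset.sum_apply, Pi.zero_apply]
    by_cases hw : ∃ j', w = e' j'
    · obtain ⟨j', rfl⟩ := hw
      have := congr_fun hg j'
      rw [Finset.sum_apply, Pi.zero_apply] at this
      simpa using this
    · push Not at hw
      exact Finset.sum_eq_zero fun i _ => by rw [Pi.smul_apply, hsupp i w hw, smul_zero]
  exact (Fintype.linearIndependent_iff.1 hli) g hfull j

end LinAlg

/-! ### Generic: coefficients of products on disjoint variable blocks -/

section Coeff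

variable {K : Type*} [Field K]

/-- Coefficient of a split exponent in a product of polynomials living on DISJOINT renamed variable
sets: it factors (seat p1 g5's private lemma, re-proved). [folklore] -/
private theorem coeff_rename_mul_rename' {σ τ : Type*} [DecidableEq τ] (f g : σ → τ)
    (hf : Function.Injective f) (hg : Function.Injective g) (hfg : ∀ a b, f a ≠ g b)
    (p q : MvPolynomial σ K) (α β : σ →₀ ℕ) :
    coeff (Finsupp.mapDomain f α + Finsupp.mapDomain g β) (rename f p * rename g q) =
      coeff α p * coeff β q := by
  classical
  rw [coeff_mul, Finset.sum_eq_single (Finsupp.mapDomain f α, Finsupp.mapDomain g β)]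
  · rw [coeff_rename_mapDomain f hf, coeff_rename_mapDomain g hg]
  · rintro ⟨y₁, y₂⟩ hy hne
    rw [Finset.HasAntidiagonal.mem_antidiagonal] at hy
    by_contra hprod
    obtain ⟨u, hu, -⟩ := coeff_rename_ne_zero f p y₁ (left_ne_zero_of_mul hprod)
    obtain ⟨v, hv, -⟩ := coeff_rename_ne_zero g q y₂ (right_ne_zero_of_mul hprod)
    subst hu hv
    apply hne
    have hfa : ∀ a, f a ∉ Set.range g := fun a ⟨b, hb⟩ => hfg a b hb.symm
    have hga : ∀ b, g b ∉ Set.range f := fun b ⟨a, ha⟩ => hfg a b ha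
    have huα : u = α := by
      ext a
      have := congr_arg (fun w : τ →₀ ℕ => w (f a)) hy
      simp only [Finsupp.coe_add, Pi.add_apply, Finsupp.mapDomain_apply hf,
        Finsupp.mapDomain_notin_range _ _ (hfa a), add_zero] at this
      exact this
    have hvβ : v = β := by
      ext b
      have := congr_arg (fun w : τ →₀ ℕ => w (g b)) hy
      simp only [Finsupp.coe_add, Pi.add_apply, Finsupp.mapDomain_apply hg,
        Finsupp.mapDomain_notin_range _ _ (hga b), zero_add] at this
      exact this
    rw [huα, hvβ]
  · intro hnot
    exact absurd (by simp only [Finset.HasAntidiagonal.mem_antidiagonal]) hnot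

/-- A product of polynomials on the variable sets `range f ∪ range g` has no monomial touching a
variable outside (seat p1 g5's private lemma, re-proved). [folklore] -/
private theorem coeff_rename_mul_rename_eq_zero' {σ τ : Type*} [DecidableEq τ] (f g : σ → τ)
    (p q : MvPolynomial σ K) (m : τ →₀ ℕ) (x : τ) (hx : m x ≠ 0) (hxf : ∀ a, f a ≠ x)
    (hxg : ∀ b, g b ≠ x) : coeff m (rename f p * rename g q) = 0 := by
  classical
  rw [coeff_mul]
  refine Finset.sum_eq_zero fun y hy => ?_
  rw [Finset.HasAntidiagonal.mem_antidiagonal] at hy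
  by_contra hprod
  obtain ⟨u, hu, -⟩ := coeff_rename_ne_zero f p y.1 (left_ne_zero_of_mul hprod)
  obtain ⟨v, hv, -⟩ := coeff_rename_ne_zero g q y.2 (right_ne_zero_of_mul hprod)
  apply hx
  rw [← hy, ← hu, ← hv, Finsupp.coe_add, Pi.add_apply,
    Finsupp.mapDomain_notin_range _ _ (fun ⟨a, ha⟩ => hxf a ha),
    Finsupp.mapDomain_notin_range _ _ (fun ⟨b, hb⟩ => hxg b hb), add_zero]

/-- Monomials of a product of renamed polynomials split along the two renamings. [folklore] -/
private theorem exists_of_mem_support_rename_mul_rename {σ τ : Type*} [DecidableEq τ] (f g : σ → τ)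
    (hf : Function.Injective f) (hg : Function.Injective g) (p q : MvPolynomial σ K)
    {m : τ →₀ ℕ} (hm : m ∈ (rename f p * rename g q).support) :
    ∃ α ∈ p.support, ∃ β ∈ q.support, m = Finsupp.mapDomain f α + Finsupp.mapDomain g β := by
  classical
  have h := support_mul _ _ hm
  rw [Finset.mem_add] at h
  obtain ⟨y₁, hy₁, y₂, hy₂, rfl⟩ := h
  rw [support_rename_of_injective hf, Finset.mem_image] at hy₁
  rw [support_rename_of_injective hg, Finset.mem_image] at hy₂
  obtain ⟨α, hα, rfl⟩ := hy₁
  obtain ⟨β, hβ, rfl⟩ := hy₂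
  exact ⟨α, hα, β, hβ, rfl⟩

end Coeff

/-! ### Hasse chain rule for `affSubst le_rfl M 0` -/

section Chain

variable {K : Type*} [Field K] {N : ℕ}

/-- `Δᵏ_u (Q(My)) = (Δᵏ_{Mu} Q)(My)`. [cite: MediniShpilka2021, Def 3.6 / Lemma 3.8 (arXiv p0017:L44-L68)] -/
private theorem hasseD_affSubst_refl' (M : Matrix (Fin N) (Fin N) K) (k : ℕ) (u : Fin N → K)
    (Q : MvPolynomial (Fin N) K) :
    hasseD k u (affSubst le_rfl M 0 Q) = affSubst le_rfl M 0 (hasseD k (M.mulVec u) Q) := by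
  unfold affSubst
  rw [hasseD_aeval_affine _ (fun i j => M (Fin.castLE le_rfl i) j)
    (fun i => (0 : Fin N → K) (Fin.castLE le_rfl i)) (fun i => rfl) k u Q]
  rfl

/-- `M · e_k` is the `k`-th column. [folklore] -/
private theorem mulVec_single_one' (M : Matrix (Fin N) (Fin N) K) (k : Fin N) :
    M.mulVec (Pi.single k 1) = fun v => M v k := by
  funext v
  show (fun j => M v j) ⬝ᵥ Pi.single k 1 = M v k
  rw [dotProduct_single, mul_one]

/-- `Δ²_{e_k} (Q(My)) = (Δ²_{col_k M} Q)(My)`. [cite: MediniShpilka2021, Lemma 3.8 / Lemma 5.13 (arXiv p0017:L61-L68, p0029:L3-L14)] -/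
theorem hasseD_two_single_affSubst_refl (M : Matrix (Fin N) (Fin N) K) (k : Fin N)
    (Q : MvPolynomial (Fin N) K) :
    hasseD 2 (Pi.single k 1) (affSubst le_rfl M 0 Q) =
      affSubst le_rfl M 0 (hasseD 2 (fun v => M v k) Q) := by
  rw [hasseD_affSubst_refl', mulVec_single_one']

/-- `∂_k∂_l (Q(My)) = (∂_{col_k M} ∂_{col_l M} Q)(My)`. [cite: MediniShpilka2021, Lemma 3.8 / Lemma 5.13 (arXiv p0017:L61-L68, p0029:L3-L14)] -/
theorem pderiv_pderiv_affSubst_refl_hasseD (M : Matrix (Fin N) (Fin N) K) (k l : Fin N)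
    (Q : MvPolynomial (Fin N) K) :
    pderiv k (pderiv l (affSubst le_rfl M 0 Q)) =
      affSubst le_rfl M 0 (hasseD 1 (fun v => M v k) (hasseD 1 (fun v => M v l) Q)) := by
  rw [← hasseD_one_single l, ← hasseD_one_single k, hasseD_affSubst_refl', hasseD_affSubst_refl',
    mulVec_single_one', mulVec_single_one']

end Chain

/-! ### The induction step `Δ ≥ 1 → Δ + 1`: combinatorics of the row blocks -/

section Step

variable {K : Type*} [Field K] {Δ : ℕ}

/-- Top gate of `ANF_Δ`, `Δ ≥ 1`, is an addition gate (wrapper of the `Δ+1` statement).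
[cite: MediniShpilka2021, Obs 5.8 (arXiv p0025:L57-L60)] -/
private theorem exists_pderiv_pderiv_anf_eq_zero_of_union_eq_univ' (hΔ : 1 ≤ Δ)
    {S S' : Finset (Fin (4 ^ Δ))} (hS : S.Nonempty) (hS' : S'.Nonempty)
    (hcov : S ∪ S' = Finset.univ) :
    ∃ k ∈ S, ∃ l ∈ S', pderiv k (pderiv l (anf K Δ)) = 0 := by
  obtain ⟨Δ', rfl⟩ : ∃ Δ', Δ = Δ' + 1 := ⟨Δ - 1, by omega⟩
  exact exists_pderiv_pderiv_anf_succ_eq_zero_of_union_eq_univ K Δ' hS hS' hcov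

/-- **Dichotomy (A)**: if `Δ ≥ 1` and `Δ²_{col_k M} ANF_{Δ+1} = 0` then column `k` of `M` vanishes on
the rows of block `b` or on the rows of its sibling block `1-b`. [cite: MediniShpilka2021, Lemma 5.13
(arXiv p0029:L3-L26), char-free replacement] -/
theorem step_dichotomy (hΔ : 1 ≤ Δ) (M : Matrix (Fin (4 ^ (Δ + 1))) (Fin (4 ^ (Δ + 1))) K)
    (k : Fin (4 ^ (Δ + 1))) (h2 : hasseD 2 (fun v => M v k) (anf K (Δ + 1)) = 0) (b : Fin 4) :
    (∀ j, M (anfBlock Δ b j) k = 0) ∨ (∀ j, M (anfBlock Δ (1 - b) j) k = 0) := by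
  have h := (anf_succ_hasseD_two_extract hΔ _ h2 b).2
  rcases mul_eq_zero.1 h with h0 | h0
  · left
    have h1 := (map_eq_zero_iff _ (rename_injective _ (anfBlock_injective Δ b))).1 h0
    rw [hasseD_one_anf_eq_zero_iff] at h1
    exact fun j => congr_fun h1 j
  · right
    have h1 := (map_eq_zero_iff _ (rename_injective _ (anfBlock_injective Δ (1 - b)))).1 h0
    rw [hasseD_one_anf_eq_zero_iff] at h1
    exact fun j => congr_fun h1 j

/-- **Cross pairs are `×`-pairs (B)**: if moreover the mixed conditions hold for `+`-pairs, a column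
living on block `b` and a column living on block `1-b` form a `×`-pair of `ANF_{Δ+1}`.
[cite: MediniShpilka2021, Lemma 5.13 (arXiv p0029:L3-L26), char-free replacement] -/
theorem step_cross (hΔ : 1 ≤ Δ) (M : Matrix (Fin (4 ^ (Δ + 1))) (Fin (4 ^ (Δ + 1))) K)
    (h2 : ∀ k, hasseD 2 (fun v => M v k) (anf K (Δ + 1)) = 0)
    (h11 : ∀ k l, pderiv k (pderiv l (anf K (Δ + 1))) = 0 →
      hasseD 1 (fun v => M v k) (hasseD 1 (fun v => M v l) (anf K (Δ + 1))) = 0)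
    (k l : Fin (4 ^ (Δ + 1))) (b : Fin 4) (hk : ∃ j, M (anfBlock Δ b j) k ≠ 0)
    (hl : ∃ j, M (anfBlock Δ (1 - b) j) l ≠ 0) :
    pderiv k (pderiv l (anf K (Δ + 1))) ≠ 0 := by
  intro hkl
  have hcross := (anf_succ_pderiv_pderiv_extract hΔ _ _ (h11 k l hkl) b).2
  -- column `k` vanishes on block `1-b`, column `l` on block `b`
  have hk' : (fun v => M v k) ∘ anfBlock Δ (1 - b) = 0 := by
    rcases step_dichotomy hΔ M k (h2 k) b with h | h
    · obtain ⟨j, hj⟩ := hk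
      exact absurd (h j) hj
    · exact funext h
  have hl' : (fun v => M v l) ∘ anfBlock Δ b = 0 := by
    rcases step_dichotomy hΔ M l (h2 l) (1 - b) with h | h
    · obtain ⟨j, hj⟩ := hl
      exact absurd (h j) hj
    · rw [sub_sub_cancel] at h
      exact funext h
  rw [hl', (hasseD_one_anf_eq_zero_iff Δ _).2 rfl, map_zero, zero_mul, add_zero] at hcross
  rcases mul_eq_zero.1 hcross with h0 | h0
  · have h1 := (map_eq_zero_iff _ (rename_injective _ (anfBlock_injective Δ b))).1 h0
    rw [hasseD_one_anf_eq_zero_iff] at h1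
    obtain ⟨j, hj⟩ := hk
    exact hj (congr_fun h1 j)
  · have h1 := (map_eq_zero_iff _ (rename_injective _ (anfBlock_injective Δ (1 - b)))).1 h0
    rw [hasseD_one_anf_eq_zero_iff] at h1
    obtain ⟨j, hj⟩ := hl
    exact hj (congr_fun h1 j)

/-- Block indices of a `×`-pair across `U_b`, `U_{1-b}` are equal or siblings. [cite: MediniShpilka2021, Obs 5.8 (arXiv p0025:L57-L60)] -/
theorem blocks_of_cross {k l : Fin (4 ^ (Δ + 1))} (hx : pderiv k (pderiv l (anf K (Δ + 1))) ≠ 0)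
    {βk βl : Fin 4} {jk jl : Fin (4 ^ Δ)} (hk : k = anfBlock Δ βk jk) (hl : l = anfBlock Δ βl jl) :
    βl = βk ∨ βl = 1 - βk := by
  by_contra h
  push Not at h
  apply hx
  subst hk hl
  refine pderiv_pderiv_anf_succ_other K Δ (b := βl) (b' := βk) (fun h' => h.1 h'.symm) ?_ jl jk
  intro h'
  exact h.2 (by rw [h', sub_sub_cancel])

/-- **Quarter structure (the heart of the step).** Under (A) and (B), for each block `b` there is a
block `β` such that the rows of block `b` of `M` live on the columns of block `β` and the rows of
block `1-b` on the columns of block `1-β`. [cite: MediniShpilka2021, Lemma 5.13 / Claim 5.11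
(arXiv p0029:L3-L26, p0026), char-free replacement] -/
theorem step_blocks (hΔ : 1 ≤ Δ) (M : Matrix (Fin (4 ^ (Δ + 1))) (Fin (4 ^ (Δ + 1))) K)
    (hM : IsUnit M.det)
    (hdis : ∀ k b', (∀ j, M (anfBlock Δ b' j) k = 0) ∨ (∀ j, M (anfBlock Δ (1 - b') j) k = 0))
    (hx : ∀ k l b', (∃ j, M (anfBlock Δ b' j) k ≠ 0) → (∃ j, M (anfBlock Δ (1 - b') j) l ≠ 0) →
      pderiv k (pderiv l (anf K (Δ + 1))) ≠ 0)
    (b : Fin 4) :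
    ∃ β : Fin 4, (∀ j w, M (anfBlock Δ b j) w ≠ 0 → ∃ j', w = anfBlock Δ β j') ∧
      (∀ j w, M (anfBlock Δ (1 - b) j) w ≠ 0 → ∃ j', w = anfBlock Δ (1 - β) j') := by
  classical
  set e := anfBlock Δ with he
  -- the column supports of the row blocks
  set U : Fin 4 → Finset (Fin (4 ^ (Δ + 1))) :=
    fun b' => Finset.univ.filter (fun w => ∃ j, M (e b' j) w ≠ 0) with hU
  have memU : ∀ b' w, w ∈ U b' ↔ ∃ j, M (e b' j) w ≠ 0 := fun b' w => by
    rw [hU, Finset.mem_filter]; exact ⟨fun h => h.2, fun h => ⟨Finset.mem_univ _, h⟩⟩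
  have hUcard : ∀ b', 4 ^ Δ ≤ (U b').card := by
    intro b'
    have h := card_le_card_of_rows_supported M hM (e b') (anfBlock_injective Δ b') (U b')
      (fun j w hw => by
        by_contra h
        exact hw ((memU b' w).2 ⟨j, h⟩))
    rwa [Fintype.card_fin] at h
  have hUne : ∀ b', (U b').Nonempty := fun b' =>
    Finset.card_pos.1 (lt_of_lt_of_le (pow_pos (by norm_num) Δ) (hUcard b'))
  have hdisj : ∀ b' w, w ∈ U b' → w ∉ U (1 - b') := by
    intro b' w hw hw'
    obtain ⟨j, hj⟩ := (memU _ _).1 hw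
    obtain ⟨j', hj'⟩ := (memU _ _).1 hw'
    rcases hdis w b' with h | h
    · exact hj (h j)
    · exact hj' (h j')
  -- a base point of `U b` in block `β`
  obtain ⟨k₀, hk₀⟩ := hUne b
  obtain ⟨β, j₀, hk₀e⟩ := exists_eq_anfBlock Δ k₀
  refine ⟨β, ?_⟩
  -- every column of `U b ∪ U (1-b)` lies in block `β` or block `1-β`
  have hin : ∀ w, w ∈ U b ∨ w ∈ U (1 - b) →
      ∃ j, w = e β j ∨ w = e (1 - β) j := by
    intro w hw
    obtain ⟨βw, jw, hwe⟩ := exists_eq_anfBlock Δ w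
    rcases hw with hw | hw
    · obtain ⟨l₀, hl₀⟩ := hUne (1 - b)
      obtain ⟨βl, jl, hle⟩ := exists_eq_anfBlock Δ l₀
      have h1 := blocks_of_cross (hx k₀ l₀ b ((memU _ _).1 hk₀) ((memU _ _).1 hl₀)) hk₀e hle
      have h2 := blocks_of_cross (hx w l₀ b ((memU _ _).1 hw) ((memU _ _).1 hl₀)) hwe hle
      refine ⟨jw, ?_⟩
      rcases h1 with h1 | h1 <;> rcases h2 with h2 | h2
      · left; rw [hwe, ← h2, h1]
      · right; rw [hwe, he]
        have : βw = 1 - β := by rw [← h1, h2, sub_sub_cancel]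
        rw [this]
      · right; rw [hwe, ← h2, h1]
      · left; rw [hwe, he]
        have : βw = β := by
          have := h2.symm.trans h1
          rw [sub_right_inj] at this
          exact this
        rw [this]
    · have h1 := blocks_of_cross (hx k₀ w b ((memU _ _).1 hk₀) ((memU _ _).1 hw)) hk₀e hwe
      refine ⟨jw, ?_⟩
      rcases h1 with h1 | h1
      · left; rw [hwe, h1]
      · right; rw [hwe, h1]
  -- hence `U b ∪ U (1-b)` IS the union `H` of the two blocks (cardinality)
  set H : Finset (Fin (4 ^ (Δ + 1))) :=
    Finset.univ.image (e β) ∪ Finset.univ.image (e (1 - β)) with hH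
  have hsub : U b ∪ U (1 - b) ⊆ H := by
    intro w hw
    rw [Finset.mem_union] at hw
    obtain ⟨j, hj | hj⟩ := hin w hw
    · exact Finset.mem_union.2 (Or.inl (Finset.mem_image.2 ⟨j, Finset.mem_univ _, hj.symm⟩))
    · exact Finset.mem_union.2 (Or.inr (Finset.mem_image.2 ⟨j, Finset.mem_univ _, hj.symm⟩))
  have hHcard : H.card ≤ (U b ∪ U (1 - b)).card := by
    have h1 : H.card ≤ 4 ^ Δ + 4 ^ Δ := by
      refine (Finset.card_union_le _ _).trans (Nat.add_le_add ?_ ?_) <;>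
        exact Finset.card_image_le.trans (by rw [Finset.card_univ, Fintype.card_fin])
    have h2 : (U b ∪ U (1 - b)).card = (U b).card + (U (1 - b)).card :=
      Finset.card_union_eq_card_add_card.2
        (Finset.disjoint_left.2 fun w hw hw' => hdisj b w hw hw')
    have := hUcard b
    have := hUcard (1 - b)
    omega
  have hUH : U b ∪ U (1 - b) = H := Finset.eq_of_subset_of_card_le hsub hHcard
  have hcover : ∀ β', (β' = β ∨ β' = 1 - β) → ∀ j, e β' j ∈ U b ∨ e β' j ∈ U (1 - b) := by
    intro β' hβ' j
    have : e β' j ∈ H := by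
      rcases hβ' with rfl | rfl
      · exact Finset.mem_union.2 (Or.inl (Finset.mem_image.2 ⟨j, Finset.mem_univ _, rfl⟩))
      · exact Finset.mem_union.2 (Or.inr (Finset.mem_image.2 ⟨j, Finset.mem_univ _, rfl⟩))
    rw [← hUH, Finset.mem_union] at this
    exact this
  -- no block of `H` is split between `U b` and `U (1-b)` (top gate of that block is `+`)
  have hnosplit : ∀ β', (β' = β ∨ β' = 1 - β) →
      (∀ j, e β' j ∈ U b) ∨ (∀ j, e β' j ∈ U (1 - b)) := by
    intro β' hβ'
    by_contra hcon
    push Not at hcon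
    obtain ⟨⟨j₁, hj₁⟩, ⟨j₂, hj₂⟩⟩ := hcon
    -- `j₁ ∉ U b` so `j₁ ∈ U(1-b)`; `j₂ ∉ U (1-b)` so `j₂ ∈ U b`
    have hj₁' : e β' j₁ ∈ U (1 - b) := (hcover β' hβ' j₁).resolve_left hj₁
    have hj₂' : e β' j₂ ∈ U b := (hcover β' hβ' j₂).resolve_right hj₂
    set S : Finset (Fin (4 ^ Δ)) := Finset.univ.filter (fun j => e β' j ∈ U b) with hS
    set S' : Finset (Fin (4 ^ Δ)) := Finset.univ.filter (fun j => e β' j ∈ U (1 - b)) with hS'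
    have hSne : S.Nonempty := ⟨j₂, Finset.mem_filter.2 ⟨Finset.mem_univ _, hj₂'⟩⟩
    have hS'ne : S'.Nonempty := ⟨j₁, Finset.mem_filter.2 ⟨Finset.mem_univ _, hj₁'⟩⟩
    have hcov : S ∪ S' = Finset.univ := by
      ext j
      constructor
      · intro _; exact Finset.mem_univ _
      · intro _
        rcases hcover β' hβ' j with h | h
        · exact Finset.mem_union.2 (Or.inl (Finset.mem_filter.2 ⟨Finset.mem_univ _, h⟩))
        · exact Finset.mem_union.2 (Or.inr (Finset.mem_filter.2 ⟨Finset.mem_univ _, h⟩))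
    obtain ⟨j, hj, j', hj', hjj'⟩ :=
      exists_pderiv_pderiv_anf_eq_zero_of_union_eq_univ' (K := K) hΔ hSne hS'ne hcov
    have hjU : e β' j ∈ U b := (Finset.mem_filter.1 hj).2
    have hj'U : e β' j' ∈ U (1 - b) := (Finset.mem_filter.1 hj').2
    apply hx (e β' j) (e β' j') b ((memU _ _).1 hjU) ((memU _ _).1 hj'U)
    rw [he, pderiv_pderiv_anf_succ_same, hjj', map_zero, mul_zero]
  -- assemble
  have hUb_ne := hUne b
  have hU1b_ne := hUne (1 - b)
  have key : ((∀ j, e β j ∈ U b) ∧ (∀ j, e (1 - β) j ∈ U (1 - b))) ∨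
      ((∀ j, e β j ∈ U (1 - b)) ∧ (∀ j, e (1 - β) j ∈ U b)) := by
    rcases hnosplit β (Or.inl rfl) with hβ | hβ <;>
      rcases hnosplit (1 - β) (Or.inr rfl) with hβ' | hβ'
    · -- both blocks inside `U b`: then `U (1-b) ⊆ H ⊆ U b`, contradiction
      exfalso
      obtain ⟨w, hw⟩ := hU1b_ne
      obtain ⟨j, hj | hj⟩ := hin w (Or.inr hw)
      · exact hdisj b w (hj ▸ hβ j) hw
      · exact hdisj b w (hj ▸ hβ' j) hw
    · exact Or.inl ⟨hβ, hβ'⟩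
    · exact Or.inr ⟨hβ, hβ'⟩
    · exfalso
      obtain ⟨w, hw⟩ := hUb_ne
      obtain ⟨j, hj | hj⟩ := hin w (Or.inl hw)
      · exact hdisj b w hw (hj ▸ hβ j)
      · exact hdisj b w hw (hj ▸ hβ' j)
  -- In the second case replace `β` by `1 - β`.
  rcases key with ⟨h1, h2⟩ | ⟨h1, h2⟩
  · refine ⟨fun j w hw => ?_, fun j w hw => ?_⟩
    · have hwU : w ∈ U b := (memU _ _).2 ⟨j, hw⟩
      obtain ⟨j', hj' | hj'⟩ := hin w (Or.inl hwU)
      · exact ⟨j', hj'⟩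
      · exact absurd (hj' ▸ h2 j') (hdisj b w hwU)
    · have hwU : w ∈ U (1 - b) := (memU _ _).2 ⟨j, hw⟩
      obtain ⟨j', hj' | hj'⟩ := hin w (Or.inr hwU)
      · exact absurd hwU (hdisj b w (hj' ▸ h1 j'))
      · exact ⟨j', hj'⟩
  · -- swap: use `1 - β`; but the statement fixes `β` from the base point, so derive a contradiction-free
    -- version: the base point `k₀ = e β j₀ ∈ U b` lies in block `β ⊆ U (1-b)` — impossible.
    exfalso
    exact hdisj b k₀ hk₀ (hk₀e ▸ h1 j₀)

end Step

/-! ### The induction step: block matrices, decomposition, conclusion -/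

section StepConclusion

variable {K : Type*} [Field K] {Δ : ℕ}

/-- A row block of `M` living on the columns of block `γ`: `(My)_{x^{(b)}_j} = (N_b y^{(γ)})_j`
renamed, where `N_b = (M_{x^{(b)}_j, y^{(γ)}_{j'}})`. [cite: MediniShpilka2021, Claim 5.11 / Lemma 5.13 (arXiv p0026, p0029:L20-L26)] -/
theorem affRow_eq_rename_block (M : Matrix (Fin (4 ^ (Δ + 1))) (Fin (4 ^ (Δ + 1))) K) (b γ : Fin 4)
    (hγ : ∀ j w, M (anfBlock Δ b j) w ≠ 0 → ∃ j', w = anfBlock Δ γ j') (j : Fin (4 ^ Δ)) :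
    ((∑ w : Fin (4 ^ (Δ + 1)), C (M (Fin.castLE le_rfl (anfBlock Δ b j)) w) * X w) +
        C ((0 : Fin (4 ^ (Δ + 1)) → K) (Fin.castLE le_rfl (anfBlock Δ b j))) :
        MvPolynomial (Fin (4 ^ (Δ + 1))) K) =
      rename (anfBlock Δ γ) ((∑ j' : Fin (4 ^ Δ),
        C ((Matrix.of fun j j' => M (anfBlock Δ b j) (anfBlock Δ γ j')) (Fin.castLE le_rfl j) j') *
          X j') + C ((0 : Fin (4 ^ Δ) → K) (Fin.castLE le_rfl j))) := by
  classical
  have hc : ∀ (n : ℕ) (i : Fin n), Fin.castLE le_rfl i = i := fun n i => rfl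
  simp only [hc, Pi.zero_apply, C_0, add_zero, map_sum, map_mul, rename_C, rename_X,
    Matrix.of_apply]
  symm
  rw [← Finset.sum_image (f := fun w => C (M (anfBlock Δ b j) w) * X w)
    (fun x _ y _ h => anfBlock_injective Δ γ h)]
  refine Finset.sum_subset (Finset.subset_univ _) fun w _ hw => ?_
  have h0 : M (anfBlock Δ b j) w = 0 := by
    by_contra h
    obtain ⟨j', rfl⟩ := hγ j w h
    exact hw (Finset.mem_image.2 ⟨j', Finset.mem_univ _, rfl⟩)
  rw [h0, C_0, zero_mul]

/-- Blockwise factorisation of `ANF_Δ` on a row block: `ANF_Δ((My)^{(b)}) = (ANF_Δ(N_b y))` renamed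
into block `γ`. [cite: MediniShpilka2021, Claim 5.11 / Lemma 5.13 (arXiv p0026, p0029:L20-L26)] -/
theorem aeval_affRow_block (M : Matrix (Fin (4 ^ (Δ + 1))) (Fin (4 ^ (Δ + 1))) K) (b γ : Fin 4)
    (hγ : ∀ j w, M (anfBlock Δ b j) w ≠ 0 → ∃ j', w = anfBlock Δ γ j') :
    aeval ((fun i : Fin (4 ^ (Δ + 1)) =>
        ((∑ w : Fin (4 ^ (Δ + 1)), C (M (Fin.castLE le_rfl i) w) * X w) +
          C ((0 : Fin (4 ^ (Δ + 1)) → K) (Fin.castLE le_rfl i)) : MvPolynomial (Fin (4 ^ (Δ + 1))) K)) ∘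
        anfBlock Δ b) (anf K Δ) =
      rename (anfBlock Δ γ)
        (affSubst le_rfl (Matrix.of fun j j' => M (anfBlock Δ b j) (anfBlock Δ γ j')) 0 (anf K Δ)) := by
  have hfun : ((fun i : Fin (4 ^ (Δ + 1)) =>
        ((∑ w : Fin (4 ^ (Δ + 1)), C (M (Fin.castLE le_rfl i) w) * X w) +
          C ((0 : Fin (4 ^ (Δ + 1)) → K) (Fin.castLE le_rfl i)) : MvPolynomial (Fin (4 ^ (Δ + 1))) K)) ∘
        anfBlock Δ b) = fun j => rename (anfBlock Δ γ) ((∑ j' : Fin (4 ^ Δ),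
        C ((Matrix.of fun j j' => M (anfBlock Δ b j) (anfBlock Δ γ j')) (Fin.castLE le_rfl j) j') *
          X j') + C ((0 : Fin (4 ^ Δ) → K) (Fin.castLE le_rfl j))) :=
    funext fun j => by rw [Function.comp_apply, affRow_eq_rename_block M b γ hγ j]
  rw [hfun]
  unfold affSubst
  rw [← AlgHom.comp_apply, comp_aeval]

/-- **Decomposition**: if the rows of block `b` of `M` live on the columns of block `γ_b` then
`ANF_{Δ+1}(My) = P₀P₁ + P₂P₃` with `P_b = ANF_Δ(N_b y^{(γ_b)})`. [cite: MediniShpilka2021, Claim 5.11 /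
Lemma 5.13 (arXiv p0026, p0029:L20-L26)] -/
theorem affSubst_anf_succ_eq_blocks (M : Matrix (Fin (4 ^ (Δ + 1))) (Fin (4 ^ (Δ + 1))) K)
    (γ : Fin 4 → Fin 4) (hγ : ∀ b j w, M (anfBlock Δ b j) w ≠ 0 → ∃ j', w = anfBlock Δ (γ b) j') :
    affSubst le_rfl M 0 (anf K (Δ + 1)) =
      rename (anfBlock Δ (γ 0)) (affSubst le_rfl
          (Matrix.of fun j j' => M (anfBlock Δ 0 j) (anfBlock Δ (γ 0) j')) 0 (anf K Δ)) *
        rename (anfBlock Δ (γ 1)) (affSubst le_rfl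
          (Matrix.of fun j j' => M (anfBlock Δ 1 j) (anfBlock Δ (γ 1) j')) 0 (anf K Δ)) +
      rename (anfBlock Δ (γ 2)) (affSubst le_rfl
          (Matrix.of fun j j' => M (anfBlock Δ 2 j) (anfBlock Δ (γ 2) j')) 0 (anf K Δ)) *
        rename (anfBlock Δ (γ 3)) (affSubst le_rfl
          (Matrix.of fun j j' => M (anfBlock Δ 3 j) (anfBlock Δ (γ 3) j')) 0 (anf K Δ)) := by
  rw [← aeval_affRow_block M 0 (γ 0) (hγ 0), ← aeval_affRow_block M 1 (γ 1) (hγ 1),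
    ← aeval_affRow_block M 2 (γ 2) (hγ 2), ← aeval_affRow_block M 3 (γ 3) (hγ 3), ← aeval_anf_succ]
  rfl

/-- A monomial `x^{(γ)α} · x^{(1-γ)β}` with `α, β ∈ supp ANF_Δ` is a monomial of `ANF_{Δ+1}`.
[cite: MediniShpilka2021, Def 8 / Obs 5.2 (arXiv p0025)] -/
theorem mem_support_anf_succ_of_blocks (γ : Fin 4) {α β : Fin (4 ^ Δ) →₀ ℕ}
    (hα : α ∈ (anf K Δ).support) (hβ : β ∈ (anf K Δ).support) :
    Finsupp.mapDomain (anfBlock Δ γ) α + Finsupp.mapDomain (anfBlock Δ (1 - γ)) β ∈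
      (anf K (Δ + 1)).support := by
  classical
  obtain ⟨hγγ, hγ2, hγ3⟩ := pair_indices γ
  rw [mem_support_iff] at hα hβ ⊢
  have hne : ∀ (δ δ' : Fin 4), δ ≠ δ' → ∀ a b, anfBlock Δ δ a ≠ anfBlock Δ δ' b :=
    fun δ δ' h a b hab => h (anfBlock_inj hab).1
  -- a variable of block `γ` occurring in the exponent
  have hα0 : α ≠ 0 := by
    rintro rfl
    exact hα (by rw [← constantCoeff_eq]; exact constantCoeff_anf Δ)
  obtain ⟨a, ha⟩ := Finsupp.ne_iff.1 hα0
  rw [Finsupp.zero_apply] at ha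
  have hxa : (Finsupp.mapDomain (anfBlock Δ γ) α + Finsupp.mapDomain (anfBlock Δ (1 - γ)) β)
      (anfBlock Δ γ a) ≠ 0 := by
    rw [Finsupp.add_apply, Finsupp.mapDomain_apply (anfBlock_injective Δ γ),
      Finsupp.mapDomain_notin_range _ _ (fun ⟨b, hb⟩ => hne _ _ hγγ b a hb), add_zero]
    exact ha
  rw [anf_succ_eq_block K Δ γ, coeff_add,
    coeff_rename_mul_rename' _ _ (anfBlock_injective Δ γ) (anfBlock_injective Δ (1 - γ))
      (hne _ _ hγγ.symm) (anf K Δ) (anf K Δ) α β,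
    coeff_rename_mul_rename_eq_zero' _ _ (anf K Δ) (anf K Δ) _ (anfBlock Δ γ a) hxa
      (fun b h => hγ2 (Or.inl (anfBlock_inj h).1))
      (fun b h => hγ3 (Or.inl (anfBlock_inj h).1)), add_zero]
  exact mul_ne_zero hα hβ

/-- **The induction step.** [cite: MediniShpilka2021, Lemma 5.13 (arXiv p0029:L3-L26), char-free replacement] -/
theorem step_support (hΔ : 1 ≤ Δ)
    (IH : ∀ N : Matrix (Fin (4 ^ Δ)) (Fin (4 ^ Δ)) K, IsUnit N.det →
      (∀ k, hasseD 2 (fun v => N v k) (anf K Δ) = 0) →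
      (∀ k l, pderiv k (pderiv l (anf K Δ)) = 0 →
        hasseD 1 (fun v => N v k) (hasseD 1 (fun v => N v l) (anf K Δ)) = 0) →
      (affSubst le_rfl N 0 (anf K Δ)).support ⊆ (anf K Δ).support)
    (M : Matrix (Fin (4 ^ (Δ + 1))) (Fin (4 ^ (Δ + 1))) K) (hM : IsUnit M.det)
    (h2 : ∀ k, hasseD 2 (fun v => M v k) (anf K (Δ + 1)) = 0)
    (h11 : ∀ k l, pderiv k (pderiv l (anf K (Δ + 1))) = 0 →
      hasseD 1 (fun v => M v k) (hasseD 1 (fun v => M v l) (anf K (Δ + 1))) = 0) :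
    (affSubst le_rfl M 0 (anf K (Δ + 1))).support ⊆ (anf K (Δ + 1)).support := by
  classical
  have hdis : ∀ k b', (∀ j, M (anfBlock Δ b' j) k = 0) ∨ (∀ j, M (anfBlock Δ (1 - b') j) k = 0) :=
    fun k b' => step_dichotomy hΔ M k (h2 k) b'
  have hx : ∀ k l b', (∃ j, M (anfBlock Δ b' j) k ≠ 0) → (∃ j, M (anfBlock Δ (1 - b') j) l ≠ 0) →
      pderiv k (pderiv l (anf K (Δ + 1))) ≠ 0 :=
    fun k l b' hk hl => step_cross hΔ M h2 h11 k l b' hk hl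
  obtain ⟨β₀, h0, h1⟩ := step_blocks hΔ M hM hdis hx 0
  obtain ⟨β₂, h2', h3⟩ := step_blocks hΔ M hM hdis hx 2
  have e10 : (1 : Fin 4) - 0 = 1 := by decide
  have e12 : (1 : Fin 4) - 2 = 3 := by decide
  rw [e10] at h1
  rw [e12] at h3
  -- the block map
  set γ : Fin 4 → Fin 4 := fun b => if b = 0 then β₀ else if b = 1 then 1 - β₀ else
    if b = 2 then β₂ else 1 - β₂ with hγdef
  have hγ0 : γ 0 = β₀ := by simp [hγdef]
  have hγ1 : γ 1 = 1 - β₀ := by simp [hγdef]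
  have hγ2 : γ 2 = β₂ := by simp [hγdef]
  have hγ3 : γ 3 = 1 - β₂ := by simp [hγdef]
  have hγ : ∀ b j w, M (anfBlock Δ b j) w ≠ 0 → ∃ j', w = anfBlock Δ (γ b) j' := by
    intro b
    have hb4 : b = 0 ∨ b = 1 ∨ b = 2 ∨ b = 3 := by fin_cases b <;> simp
    rcases hb4 with rfl | rfl | rfl | rfl
    · rw [hγ0]; exact h0
    · rw [hγ1]; exact h1
    · rw [hγ2]; exact h2'
    · rw [hγ3]; exact h3
  -- the diagonal blocks satisfy the induction hypothesis
  have hN : ∀ b, (affSubst le_rfl (Matrix.of fun j j' => M (anfBlock Δ b j) (anfBlock Δ (γ b) j'))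
      0 (anf K Δ)).support ⊆ (anf K Δ).support := by
    intro b
    refine IH _ ?_ ?_ ?_
    · exact isUnit_det_block' M hM _ _ (anfBlock_injective Δ b) (fun j w hw => by
        by_contra h
        obtain ⟨j', rfl⟩ := hγ b j w h
        exact hw j' rfl)
    · intro j'
      exact (anf_succ_hasseD_two_extract hΔ (fun v => M v (anfBlock Δ (γ b) j')) (h2 _) b).1
    · intro j' j'' hjj
      refine (anf_succ_pderiv_pderiv_extract hΔ (fun v => M v (anfBlock Δ (γ b) j'))
        (fun v => M v (anfBlock Δ (γ b) j'')) (h11 _ _ ?_) b).1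
      rw [pderiv_pderiv_anf_succ_same, hjj, map_zero, mul_zero]
  -- conclusion
  rw [affSubst_anf_succ_eq_blocks M γ hγ, hγ0, hγ1, hγ2, hγ3]
  intro m hm
  rcases Finset.mem_union.1 (support_add hm) with hm | hm
  · obtain ⟨α, hα, β, hβ, rfl⟩ := exists_of_mem_support_rename_mul_rename _ _
      (anfBlock_injective Δ β₀) (anfBlock_injective Δ (1 - β₀)) _ _ hm
    have hα' := hN 0 (by rw [hγ0]; exact hα)
    have hβ' := hN 1 (by rw [hγ1]; exact hβ)
    exact mem_support_anf_succ_of_blocks β₀ hα' hβ'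
  · obtain ⟨α, hα, β, hβ, rfl⟩ := exists_of_mem_support_rename_mul_rename _ _
      (anfBlock_injective Δ β₂) (anfBlock_injective Δ (1 - β₂)) _ _ hm
    have hα' := hN 2 (by rw [hγ2]; exact hα)
    have hβ' := hN 3 (by rw [hγ3]; exact hβ)
    exact mem_support_anf_succ_of_blocks β₂ hα' hβ'

end StepConclusion

/-! ### Base cases `Δ = 0`, `Δ = 1`, the theorem, and the downstairs packaging -/

section Base

variable {K : Type*} [Field K]

/-- The constant term of `Δ²_{e_k} P` is the coefficient of `y_k²` in `P` (every characteristic).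
[cite: MediniShpilka2021, Def 3.6 (arXiv p0017:L44-L49)] -/
theorem coeff_zero_hasseD_two_single {σ : Type*} [DecidableEq σ] (P : MvPolynomial σ K) (k : σ) :
    coeff 0 (hasseD 2 (Pi.single k 1) P) = coeff (Finsupp.single k 2) P := by
  classical
  induction P using MvPolynomial.induction_on' with
  | monomial m a =>
    rw [hasseD_single_monomial, C_1, one_pow, mul_one, X_pow_eq_monomial,
      show (((m k).choose 2 : ℕ) : MvPolynomial σ K) = C (((m k).choose 2 : ℕ) : K) from
        (map_natCast C _).symm, C_mul_monomial, monomial_mul, coeff_monomial, coeff_monomial]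
    by_cases hm : m = Finsupp.single k 2
    · subst hm
      rw [if_pos rfl, Finsupp.erase_single, Finsupp.single_eq_same, Nat.sub_self,
        Finsupp.single_zero, add_zero, if_pos rfl, Nat.choose_self, Nat.cast_one, one_mul, mul_one]
    · rw [if_neg hm]
      split_ifs with hE
      · rw [Finsupp.add_eq_zero_iff] at hE
        have hmk : m = Finsupp.single k (m k) := by
          conv_lhs => rw [← Finsupp.erase_add_single k m, hE.1, zero_add]
        have hle : m k - 2 = 0 := Finsupp.single_eq_zero.1 hE.2
        have hne : m k ≠ 2 := fun h2 => hm (by rw [hmk, h2])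
        have hlt : m k < 2 := by omega
        rw [Nat.choose_eq_zero_of_lt hlt, Nat.cast_zero, zero_mul, mul_zero]
      · rfl
  | add p q hp hq => rw [hasseD_add, coeff_add, coeff_add, hp, hq]

/-- An exponent of degree `2` with an entry `≥ 2` is `2e_k`. [folklore] -/
private theorem eq_single_two_of_degree_two {σ : Type*} {m : σ →₀ ℕ} (hdeg : m.degree = 2) {k : σ}
    (hk : 2 ≤ m k) : m = Finsupp.single k 2 := by
  classical
  have hmk : m k = 2 := le_antisymm (hdeg ▸ Finsupp.le_degree k m) hk
  have hsupp : m.support ⊆ {k} := by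
    intro i hi
    rw [Finset.mem_singleton]
    by_contra hik
    have hki : k ∈ m.support := Finsupp.mem_support_iff.2 (by omega)
    have hsub : ({i, k} : Finset σ) ⊆ m.support := by
      intro x hx
      rcases Finset.mem_insert.1 hx with rfl | hx
      · exact hi
      · rw [Finset.mem_singleton] at hx; rw [hx]; exact hki
    have h1 : m i + m k ≤ m.degree := by
      rw [Finsupp.degree_apply, ← Finset.sum_pair hik]
      exact Finset.sum_le_sum_of_subset hsub
    have := Finsupp.mem_support_iff.1 hi
    omega
  rw [Finsupp.support_subset_singleton.1 hsupp, hmk]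

/-- A multilinear exponent of degree `2` is `e_k + e_l`, `k ≠ l`. [folklore] -/
private theorem eq_single_add_single_of_degree_two {σ : Type*} {m : σ →₀ ℕ} (hdeg : m.degree = 2)
    (h1 : ∀ k, m k ≤ 1) : ∃ k l, k ≠ l ∧ m = Finsupp.single k 1 + Finsupp.single l 1 := by
  classical
  have hval : ∀ i ∈ m.support, m i = 1 := fun i hi => by
    have := Finsupp.mem_support_iff.1 hi
    have := h1 i
    omega
  have hcard : m.support.card = 2 := by
    rw [← hdeg, Finsupp.degree_apply, Finset.card_eq_sum_ones]
    exact (Finset.sum_congr rfl hval).symm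
  obtain ⟨k, l, hkl, hs⟩ := Finset.card_eq_two.1 hcard
  refine ⟨k, l, hkl, ?_⟩
  ext i
  rw [Finsupp.add_apply, Finsupp.single_apply, Finsupp.single_apply]
  by_cases hik : i ∈ m.support
  · rw [hval i hik]
    rw [hs, Finset.mem_insert, Finset.mem_singleton] at hik
    rcases hik with rfl | rfl
    · rw [if_pos rfl, if_neg hkl.symm, add_zero]
    · rw [if_neg hkl, if_pos rfl, zero_add]
  · have h0 : m i = 0 := by simpa using hik
    rw [hs, Finset.mem_insert, Finset.mem_singleton, not_or] at hik
    rw [h0, if_neg (Ne.symm hik.1), if_neg (Ne.symm hik.2), add_zero]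

/-- **Base `Δ = 1`**: `ANF_1(My)` is a quadratic form; `Δ²_{e_k}` kills the squares and the mixed
conditions kill the `+`-pairs, so only the two `×`-pair monomials `y^{(b)}y^{(1-b)}` survive.
[cite: MediniShpilka2021, Lemma 5.13 (arXiv p0029:L3-L26), char-free replacement, smallest case] -/
theorem base_one (M : Matrix (Fin (4 ^ 1)) (Fin (4 ^ 1)) K)
    (h2 : ∀ k, hasseD 2 (fun v => M v k) (anf K 1) = 0)
    (h11 : ∀ k l, pderiv k (pderiv l (anf K 1)) = 0 →
      hasseD 1 (fun v => M v k) (hasseD 1 (fun v => M v l) (anf K 1)) = 0) :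
    (affSubst le_rfl M 0 (anf K 1)).support ⊆ (anf K 1).support := by
  classical
  set P := affSubst le_rfl M 0 (anf K 1) with hPdef
  have hPhom : P.IsHomogeneous 2 := by
    have h1 : (anf K 1).IsHomogeneous 2 := isHomogeneous_anf K 1
    exact isHomogeneous_affSubst_zero le_rfl M h1
  have hd2 : ∀ k, hasseD 2 (Pi.single k 1) P = 0 := fun k => by
    rw [hPdef, hasseD_two_single_affSubst_refl, h2 k]
    unfold affSubst
    rw [map_zero]
  have hd11 : ∀ k l, pderiv k (pderiv l (anf K 1)) = 0 → pderiv k (pderiv l P) = 0 := fun k l hkl => by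
    rw [hPdef, pderiv_pderiv_affSubst_refl_hasseD, h11 k l hkl]
    unfold affSubst
    rw [map_zero]
  intro m hm
  have hcm : coeff m P ≠ 0 := mem_support_iff.1 hm
  have hdeg : m.degree = 2 := by
    rw [Finsupp.degree_eq_weight_one]
    exact hPhom hcm
  by_cases hsq : ∃ k, 2 ≤ m k
  · -- a square `y_k²`: killed by `Δ²_{e_k}`
    exfalso
    obtain ⟨k, hk⟩ := hsq
    have hm2 := eq_single_two_of_degree_two hdeg hk
    apply hcm
    rw [hm2, ← coeff_zero_hasseD_two_single, hd2 k, coeff_zero]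
  · push Not at hsq
    obtain ⟨k, l, hkl, hmkl⟩ :=
      eq_single_add_single_of_degree_two hdeg (fun k => Nat.lt_succ_iff.1 (hsq k))
    -- `coeff m P` is the constant term of `∂_k ∂_l P`
    have hcoeff : coeff 0 (pderiv k (pderiv l P)) = coeff m P := by
      have h := coeff_pderiv_pderiv_mixed hkl P (e := m)
        (by rw [hmkl, Finsupp.add_apply, Finsupp.single_eq_same]; omega)
        (by rw [hmkl, Finsupp.add_apply, Finsupp.single_eq_same]; omega)
      have e0 : m - Finsupp.single k 1 - Finsupp.single l 1 = 0 := by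
        rw [hmkl, add_tsub_cancel_left, tsub_self]
      have emk : m k = 1 := by
        rw [hmkl, Finsupp.add_apply, Finsupp.single_eq_same, Finsupp.single_eq_of_ne hkl, add_zero]
      have eml : m l = 1 := by
        rw [hmkl, Finsupp.add_apply, Finsupp.single_eq_same, Finsupp.single_eq_of_ne (Ne.symm hkl),
          zero_add]
      rw [e0, emk, eml, Nat.cast_one, one_mul, one_mul] at h
      exact h
    by_cases hx : pderiv k (pderiv l (anf K 1)) = 0
    · exfalso
      apply hcm
      rw [← hcoeff, hd11 k l hx, coeff_zero]
    · -- a `×`-pair of `ANF_1 = y₀y₁ + y₂y₃`: `{k, l}` is a sibling pair of blocks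
      have hj : ∀ j j' : Fin (4 ^ 0), j = j' := fun j j' =>
        Fin.ext (by have := j.2; have := j'.2; simp only [pow_zero] at *; omega)
      obtain ⟨βk, jk, hke⟩ := exists_eq_anfBlock 0 k
      obtain ⟨βl, jl, hle⟩ := exists_eq_anfBlock 0 l
      have hβ := blocks_of_cross (Δ := 0) hx hke hle
      have hβl : βl = 1 - βk := by
        rcases hβ with h | h
        · exfalso
          apply hkl
          rw [hke, hle, h, hj jl jk]
        · exact h
      have hm' : m = Finsupp.mapDomain (anfBlock 0 βk) (Finsupp.single jk 1) +
          Finsupp.mapDomain (anfBlock 0 (1 - βk)) (Finsupp.single jk 1) := by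
        rw [hmkl, Finsupp.mapDomain_single, Finsupp.mapDomain_single, hke, hle, hβl, hj jl jk]
      have hsupp0 : Finsupp.single jk 1 ∈ (anf K 0).support := by
        rw [show anf K 0 = X ⟨0, by norm_num⟩ from rfl, support_X, Finset.mem_singleton,
          hj jk ⟨0, by norm_num⟩]
      rw [hm']
      exact mem_support_anf_succ_of_blocks βk hsupp0 hsupp0

/-- **The ANF structure lemma (upstairs form).** If `M` is invertible, `Δ²_{col_k M} ANF_Δ = 0` for
all `k` and `∂_{col_k M} ∂_{col_l M} ANF_Δ = 0` for all `+`-pairs `(k, l)` of `ANF_Δ`, then every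
monomial of `ANF_Δ(My)` is a monomial of `ANF_Δ`. [cite: MediniShpilka2021, Lemma 5.13
(arXiv p0029:L3-L26), characteristic-free replacement of its second bullet] -/
theorem support_affSubst_anf_subset_of_cols :
    ∀ (Δ : ℕ) (M : Matrix (Fin (4 ^ Δ)) (Fin (4 ^ Δ)) K), IsUnit M.det →
      (∀ k, hasseD 2 (fun v => M v k) (anf K Δ) = 0) →
      (∀ k l, pderiv k (pderiv l (anf K Δ)) = 0 →
        hasseD 1 (fun v => M v k) (hasseD 1 (fun v => M v l) (anf K Δ)) = 0) →
      (affSubst le_rfl M 0 (anf K Δ)).support ⊆ (anf K Δ).support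
  | 0 => fun M _ _ _ => support_affSubst_anf_zero_subset M
  | 1 => fun M _ h2 h11 => base_one M h2 h11
  | Δ + 2 => fun M hM h2 h11 =>
      step_support (Δ := Δ + 1) (by omega) (support_affSubst_anf_subset_of_cols (Δ + 1)) M hM h2 h11

/-- **The ANF structure lemma (downstairs form, `P = ANF_Δ(My)`).** If `Δ²_{e_k} P = 0` for all `k`
and `∂_k∂_l P = 0` for every `+`-pair `(k,l)` of `ANF_Δ`, then `supp P ⊆ supp ANF_Δ`.
[cite: MediniShpilka2021, Lemma 5.13 (arXiv p0029:L3-L26), characteristic-free replacement] -/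
theorem support_affSubst_anf_subset (Δ : ℕ) (M : Matrix (Fin (4 ^ Δ)) (Fin (4 ^ Δ)) K)
    (hM : IsUnit M.det)
    (h2 : ∀ k, hasseD 2 (Pi.single k 1) (affSubst le_rfl M 0 (anf K Δ)) = 0)
    (h11 : ∀ k l, pderiv k (pderiv l (anf K Δ)) = 0 →
      pderiv k (pderiv l (affSubst le_rfl M 0 (anf K Δ))) = 0) :
    (affSubst le_rfl M 0 (anf K Δ)).support ⊆ (anf K Δ).support :=
  support_affSubst_anf_subset_of_cols Δ M hM
    (fun k => eq_zero_of_affSubst_eq_zero le_rfl hM 0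
      (by rw [← hasseD_two_single_affSubst_refl]; exact h2 k))
    (fun k l hkl => eq_zero_of_affSubst_eq_zero le_rfl hM 0
      (by rw [← pderiv_pderiv_affSubst_refl_hasseD]; exact h11 k l hkl))

/-- **`h513'` — the all-fields Lemma 5.13 core.** If `P = ANF_Δ(My)` (`M` invertible) has a monomial
outside `supp ANF_Δ`, then some order-2 Hasse derivative `Δ²_{e_k} P ≠ 0`, or some `+`-pair `(k,l)` of
`ANF_Δ` has `∂_k∂_l P ≠ 0` (while `Δ²_{e_k} ANF_Δ = 0 = ∂_k∂_l ANF_Δ`: multilinearity resp. the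
`+`-gate). In characteristic `0` (or `> 2`) the first alternative is `∂²P/∂y_k² ≠ 0`, the printed
second bullet. [cite: MediniShpilka2021, Lemma 5.13 (arXiv p0029:L3-L26), characteristic-free form] -/
theorem hasse_separates_affSubst_anf (Δ : ℕ) (M : Matrix (Fin (4 ^ Δ)) (Fin (4 ^ Δ)) K)
    (hM : IsUnit M.det) (hsub : ¬ (affSubst le_rfl M 0 (anf K Δ)).support ⊆ (anf K Δ).support) :
    (∃ k, hasseD 2 (Pi.single k 1) (affSubst le_rfl M 0 (anf K Δ)) ≠ 0) ∨
      (∃ k l, pderiv k (pderiv l (anf K Δ)) = 0 ∧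
        pderiv k (pderiv l (affSubst le_rfl M 0 (anf K Δ))) ≠ 0) := by
  by_contra h
  push Not at h
  exact hsub (support_affSubst_anf_subset Δ M hM h.1 h.2)

/-- **`h513H` in the binder shape of seat x5 g3's `MS2021.thm35Core_of_bricks_hasse` /
`MS2021_thm_35_of_bricks_hasse`** (`MS21ANFThm35HasseBranch`): feed this as the `h513H` brick.
[cite: MediniShpilka2021, Lemma 5.13 (arXiv p0029:L3-L26), characteristic-free form] -/
theorem anf_h513H (Δ : ℕ) (M : Matrix (Fin (4 ^ Δ)) (Fin (4 ^ Δ)) K) (hM : IsUnit M.det)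
    (hsub : ¬ (affSubst le_rfl M 0 (anf K Δ)).support ⊆ (anf K Δ).support) :
    (∃ i j, pderiv i (pderiv j (anf K Δ)) = 0 ∧
        pderiv i (pderiv j (affSubst le_rfl M 0 (anf K Δ))) ≠ 0) ∨
      (∃ k, hasseD 2 (Pi.single k 1) (affSubst le_rfl M 0 (anf K Δ)) ≠ 0) :=
  (hasse_separates_affSubst_anf Δ M hM hsub).symm

end Base

end MS2021

end Literature.Computability.AlgebraicComplexity
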